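import Summits.HodgeConjecture.HodgeConjecture.Theorems.PadicSemiregularLiftHodgeAbelianVarietiesEStepDefs
import Summits.HodgeConjecture.HodgeConjecture.Theorems.PadicSemiregularLiftHodgeAbelianVarietiesStubSplitSixfolds
import Summits.HodgeConjecture.HodgeConjecture.Theorems.HeckePrymWeilProductDescentTransfer
import Literature.AlgebraicGeometry.HodgeTheory.WeilClassesFourfoldsStep2
import Literature.AlgebraicGeometry.HodgeTheory.WeilClassesSixfolds
import Literature.AlgebraicGeometry.HodgeTheory.WeilClasses
import Literature.AlgebraicGeometry.Motives.HyperbolicWeilType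
import Literature.AlgebraicGeometry.Motives.AbelianVarietyProduct
import Literature.AlgebraicGeometry.Motives.Varieties
import Literature.AlgebraicGeometry.HodgeTheory.AlgebraicClassesCupAbelianVariety
import Literature.AlgebraicGeometry.HodgeTheory.HodgeTypePullback
import Literature.AlgebraicGeometry.HodgeTheory.CupPreservesHodgeTypeOfDeRham
import Literature.AlgebraicGeometry.HodgeTheory.HodgeFiltrationModelsReductionProofs
import Literature.AlgebraicGeometry.HodgeTheory.ComplexConjugationHolds
import Literature.AlgebraicGeometry.Motives.ComplexPointsOrientation
import Literature.NumberTheory.Transcendental.DeRhamTheoremMultiplicative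
import Literature.AlgebraicGeometry.HodgeTheory.WeilClassesDescending

/-!
# Crux `HodgeAbelianVarieties` (stmt-HodgeConjecture-1333), line `e-step-secant-induction` — stub `stub_descend`: DESCENDING, uniformly in `n`

The registered stub (gen 3)
`stub_descend : ∀ n d : ℕ, 2 ≤ n → 0 < d → Stubs.WeilAlgebraicSplitHyperplane (n + 1) d → WeilAlgebraicAll n d`
(vocabulary: `Theorems/PadicSemiregularLiftHodgeAbelianVarietiesEStepDefs`,
`Theorems/PadicSemiregularLiftHodgeAbelianVarietiesStubSplitSixfolds`): the Weil classes of EVERY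
Weil-type pair `(A, φ)` of dimension `2n`, `φ ≫ φ = -d`, are algebraic as soon as they are on every
SPLIT pair of dimension `2(n+1)` (split = hyperbolic for a `K`-symmetrised hyperplane class). This is
Schoen's product trick (Compositio 114 (1998) §10; Koike 2004 Rem. 2.1; Markman arXiv:2509.23403
§11.5 Step 2), printed for `6 → 4` and dimension-free in its mechanism. The tree holds the `n = 2`
decomposition as two NAMED FACTS + a proved assembly (`WeilClassesFourfoldsFromSixfolds`:
`Markman2025_exists_weilTypeSurface_prod_isHyperbolicWeilType`,
`Schoen1998_weilClasses_algebraic_of_prod_surface`,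
`Markman2025_weilClasses_algebraic_abelianFourfold_holds_of`). This file:

1. states the two facts for ALL `n ≥ 1` (same binder shapes, `2 ↦ n`, `3 ↦ n + 1`), inline, for the
   gate to relocate to `Literature/AlgebraicGeometry/HodgeTheory/WeilClassesDescending`:
   `exists_weilTypeSurface_prod_isHyperbolicWeilType_all` (PARTNER SURFACE: every printed
   ingredient is stated in every even dimension — van Geemen LNM 1594 Lemma 5.2, 5.3–5.8, 5.4
   (5.4.1); Markman §11.5 Step 1 (split ⟺ discriminant `(-1)ⁿ`) and Step 2 (multiplicativity,
   every discriminant in every even dimension)) and `Schoen1998_weilClasses_algebraic_of_prod_surface_all`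
   (SCHOEN'S TRANSFER `2(n+1) → 2n`);
2. PROVES the transfer fact for all `n`, on the tree's real carriers, GRANTED two classical named
   facts of the tree — Lefschetz `(1,1)` (`lefschetzOneOne_rational`) and the Hodge index theorem
   for surfaces (`hodgeIndex_surface`) — and nothing else
   (`Schoen1998_weilClasses_algebraic_of_prod_surface_all_of_lefschetzOneOne_of_hodgeIndex`):
   the upward half is the tree's rational Weil projector
   (`WeilClassesProducts.weilEigencomponents_cupProduct_fst_snd_mem_algebraicClasses`, all `n`), the
   Hodge type `(n+1,n+1)` of `pr_A^* c ∪ pr_S^* u` comes from the THEOREMS `nonempty_hodgeModel_holds`,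
   `exists_deRhamIsoFamily_holds`, `hodgePQ_independent_of_hodgeModel_holds`, the downward half is
   Schoen's `pr_{A*}((P±±) ∪ pr_S^* t)` along the tree's REAL Gysin maps `complexGysin μ` (Poincaré
   duality, Künneth, Borel–Moore base change are theorems: `HeckePrymWeilProductDescentTransfer`), the
   partner divisor class `t` with `u± ∪ t ≠ 0` is `exists_algebraic_partner_of_hodgeIndex` (this is
   where the two named facts enter), products with `pr_S^* t` stay algebraic by moving divisors on
   the abelian variety `A × S` (`AbelianVariety.cupProduct_mem_algebraicClasses_one`);
3. PROVES the stub CONDITIONALLY, by the three-line assembly uniform in `n`: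
   `stub_descend_of_partner_of_schoen : (i)_all → (iii)_all → <stub_descend verbatim>` (registered
   sub-goal), hence `stub_descend_of_partner_of_lefschetzOneOne_of_hodgeIndex :
   (i)_all → lefschetzOneOne_rational → (∀ X, hodgeIndex_surface X) → <stub_descend verbatim>`;
4. records that the stub is an instance of the summit (`descend_of_hodgeConjectureFor`). At `n = 2`
   the `_all` facts specialise DEFINITIONALLY (`2 + 1 = 3`) to the tree's `n = 2` facts of
   `WeilClassesFourfoldsFromSixfolds` (not imported here: that module is not yet built on the farm;
   the one-line specialisations `fun d hd … => h 2 two_pos d hd …` are to be appended once it is).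

What is NOT proved (census): the partner-surface fact (i)_all. Missing infrastructure, as Lean
signatures the proof would need: (a) `H¹` of a product and `H^• = ⋀^• H¹` on `complexBetti`
(`Motives.abelianVarietyCohomologyExteriorH1`, named, unproved) to get `dim E± = 1` and the rational
degree-one model WITH SIGNATURE (Hodge–Riemann in degree one); (b) a Weil surface with PRESCRIBED
discriminant as an `AbelianVariety ℂ` — the tree has `E_τ × E_τ` (`WeilSurfaceSquareModel`,
`exists_weilType_abelianSurfaces_holds`) but not its `K`-compatible Néron–Severi classes / their
discriminants on the carriers; (c) the hyperplane class of a (weighted Segre) projective embedding of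
`A.prod S` in `complexBetti`; the arithmetic core (Landherr via Meyer) IS proved in the tree
(`aimingArithmetic`, `Theorems/HeckePrymWeilAimedDescendingAiming`; frame transport
`isHyperbolicWeilType_prod_of_rationalModels`).

Audit of the gen-3 statement (harmless points, recorded): `d` a perfect square is print's own
convention ("`d` a positive integer", `K = ℚ(√-d)`); `WeilAlgebraicAll n d` also quantifies over
pairs `(A, φ)` whose `K`-signature is not `(n,n)` — there the only rational `(n,n)` class of the Weil
plane is `0` in print, and the case `c = 0` is trivially algebraic here, the partner fact being
invoked only with a NON-ZERO rational `(n,n)` Weil class (which forces signature `(n,n)`, van Geemen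
5.2 (6)); the Weil plane is rendered by `weilClassesOf` (simultaneous eigenclasses of all
`(x·𝟙 + y·φ)^*`, no eigenvalue collision for any `d`, unlike the single test endomorphism `(𝟙+φ)^*`
of `Motives.exists_cmWeilSurface_aimedSplitProduct`, false at `d ∈ {1,3}`); the hyperbolic antecedent
of `WeilAlgebraicSplitHyperplane (n+1) d` is satisfiable but not yet EXHIBITED in the tree (no Weil
`2(n+1)`-fold with a computed rational Lagrangian `H¹`-frame) — immaterial for truth.
-/

set_option linter.dupNamespace false

noncomputable section

open CategoryTheory
open Literature.AlgebraicGeometry Literature.AlgebraicGeometry.Motives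
  Literature.AlgebraicGeometry.HodgeTheory
open Literature.AlgebraicTopology.SingularHomology

/-! ### The two printed facts, for all `n` (named facts; relocated by the gate) -/

namespace Literature.AlgebraicGeometry.HodgeTheory

end Literature.AlgebraicGeometry.HodgeTheory

namespace Summit.HodgeConjecture.HodgeConjecture.Cruxes.HodgeAbelianVarieties.EStepSecantInduction.Stubs.Descend

open Summit.HodgeConjecture.HodgeConjecture.Theorems
  (mem_algebraicClasses_of_complexGysin_fst_cupProduct complexGysin_fst_map_snd_ne_zero
    exists_algebraic_partner_of_hodgeIndex)

/-! ### Schoen's transfer for all `n`, proved modulo Lefschetz `(1,1)` and Hodge index -/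

/-- **Schoen's transfer `2(n+1) → 2n` holds for every `n ≥ 1`, granted Lefschetz `(1,1)`
(`lefschetzOneOne_rational`) and the Hodge index theorem for surfaces (`hodgeIndex_surface`).**
Proof (Schoen 1998 §10, proof of the Proposition; Markman §11.5 Step 2), on the tree's real
carriers: write the rational `(n,n)` Weil class as `c = c₊ + c₋` and the surface's as `u = u₊ + u₋`;
`P = pr₁^*c ∪ pr₂^*u` is rational of Hodge type `(n+1,n+1)` on `A₁ × A₂` (Hodge models exist,
de Rham's theorem, independence of the model — theorems of the tree), so the rational Weil projector
(`weilEigencomponents_cupProduct_fst_snd_mem_algebraicClasses`) and the hypothesis make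
`P±± = pr₁^*c± ∪ pr₂^*u±` algebraic; the two named facts give an algebraic divisor class `t` on `A₂`
with `u± ∪ t ≠ 0` (`exists_algebraic_partner_of_hodgeIndex`, eigenvalues `(1 ± i√d)²` of
`(𝟙 + φ₂)^*`); `P±± ∪ pr₂^*t` is algebraic (moving divisors by translations on the abelian variety
`A₁ × A₂`), its Gysin image under `pr₁` is algebraic and equals `ε± · c±` with
`ε± · 1 = pr_{1*}pr₂^*(u± ∪ t) ≠ 0` (fibre integral of a non-zero top class, along the tree's real
Gysin maps `complexGysin μ`), so `c±` and `c` are algebraic.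
[cite: Schoen1998HodgeWeilAddendum, §10 (Proposition and proof, pp. 332–333)]
[cite: Markman2025SurveySecant, §11.5 Step 2] -/
theorem Schoen1998_weilClasses_algebraic_of_prod_surface_all_of_lefschetzOneOne_of_hodgeIndex
    (hL : lefschetzOneOne_rational) (hHI : ∀ X : SchemeOver ℂ, hodgeIndex_surface X) :
    Literature.AlgebraicGeometry.HodgeTheory.Schoen1998_weilClasses_algebraic_of_prod_surface_all := by
  intro n hn d hd A₁ φ₁ A₂ φ₂ _ hA₁ _ _ hA₂ _ hwt hB c hc hcH hcW
  obtain ⟨bp, bm, hbp, hbm, hbr, hbH, hbp0, -⟩ := hwt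
  -- smoothness of the product and the orientation family of the real Gysin maps
  have hAB : IsSmoothProjective (2 * (n + 1)) (A₁.prod A₂).X := isSmoothProjective_prod_two_mul hA₁ hA₂
  let μ : OrientationFamily := fun _ _ h ↦ Classical.choice (Motives.ComplexPoints.isOrientableOver ℂ h)
  -- `c = c₊ + c₋`
  obtain ⟨cp, hcp, cm, hcm, rfl⟩ := Submodule.mem_sup.1 hcW
  -- Hodge type `(n+1, n+1)` of `P = pr₁^* c ∪ pr₂^* u` (theorems of the tree)
  have hI := hodgePQ_independent_of_hodgeModel_holds
  have hfst : PreservesHodgeType (2 * (n + 1)) (2 * n) (AbelianVariety.fst A₁ A₂).hom.hom.hom :=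
    preservesHodgeType_of_nonempty_hodgeModel hI nonempty_hodgeModel_holds hAB hA₁ _
  have hsnd : PreservesHodgeType (2 * (n + 1)) (2 * 1) (AbelianVariety.snd A₁ A₂).hom.hom.hom :=
    preservesHodgeType_of_nonempty_hodgeModel hI nonempty_hodgeModel_holds hAB hA₂ _
  have hcupH : CupPreservesHodgeType (2 * (n + 1)) (A₁.prod A₂).X :=
    cupPreservesHodgeType_of_nonempty_hodgeModel hI nonempty_hodgeModel_holds
      (fun E _ _ _ ↦ Literature.NumberTheory.Transcendental.exists_deRhamIsoFamily_holds E) hAB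
  have h : 2 * n + 2 * 1 = 2 * (n + 1) := by ring
  have hH := isOfHodgeType_cupProduct_map_map (p₁ := AbelianVariety.fst A₁ A₂)
    (p₂ := AbelianVariety.snd A₁ A₂) h hfst hsnd hcupH hcH hbH
  -- upward half: `P±± = pr₁^* c± ∪ pr₂^* u±` are algebraic on `A₁ × A₂`
  obtain ⟨hP, hM⟩ := weilEigencomponents_cupProduct_fst_snd_mem_algebraicClasses hn one_pos hd h hA₁
    hA₂ hB hcp hcm hbp hbm hc hbr hH
  -- the partner divisor class `t` on `A₂` (Lefschetz `(1,1)` + Hodge index)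
  have hconj : starRingEnd ℂ (1 + Complex.I * (Real.sqrt (d : ℝ) : ℂ)) =
      1 - Complex.I * (Real.sqrt (d : ℝ) : ℂ) := by
    rw [map_add, map_one, map_mul, Complex.conj_I, Complex.conj_ofReal, neg_mul, sub_eq_add_neg]
  -- the two characters `(1 ± i√d)²` of `(𝟙 + φ₂)^*` on the surface differ (by `4i√d ≠ 0`)
  have hα : (1 + Complex.I * (Real.sqrt (d : ℝ) : ℂ)) ^ (2 * 1) ≠
      starRingEnd ℂ ((1 + Complex.I * (Real.sqrt (d : ℝ) : ℂ)) ^ (2 * 1)) := by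
    rw [map_pow, hconj]
    intro h
    have hsq : (Real.sqrt (d : ℝ) : ℂ) ≠ 0 := by
      rw [Ne, Complex.ofReal_eq_zero]
      exact (Real.sqrt_pos.mpr (by exact_mod_cast hd)).ne'
    have h4 : (4 : ℂ) * (Complex.I * (Real.sqrt (d : ℝ) : ℂ)) = 0 := by linear_combination h
    exact mul_ne_zero Complex.I_ne_zero hsq
      ((mul_eq_zero.mp h4).resolve_left (by norm_num : (4 : ℂ) ≠ 0))
  have hbp' : complexBetti.map (𝟙 A₂ + φ₂).hom.hom.hom 2 bp =
      (1 + Complex.I * (Real.sqrt (d : ℝ) : ℂ)) ^ (2 * 1) • bp := by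
    have e := (mem_weilClassesPlus_iff.mp hbp) 1 1
    simp only [Nat.cast_one, one_mul, one_smul] at e
    exact e
  have hbm' : complexBetti.map (𝟙 A₂ + φ₂).hom.hom.hom 2 bm =
      starRingEnd ℂ ((1 + Complex.I * (Real.sqrt (d : ℝ) : ℂ)) ^ (2 * 1)) • bm := by
    have e := (mem_weilClassesMinus_iff.mp hbm) 1 1
    simp only [Nat.cast_one, one_mul, one_smul] at e
    rw [map_pow, hconj]
    exact e
  have hb0 : bp + bm ≠ 0 := by
    intro h0
    have hmem : bp ∈ weilClassesMinus A₂ φ₂ 1 d := by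
      rw [eq_neg_of_add_eq_zero_left h0]
      exact Submodule.neg_mem _ hbm
    exact hbp0 (Submodule.disjoint_def.1
      (disjoint_weilClassesPlus_weilClassesMinus A₂ φ₂ one_pos hd) bp hbp hmem)
  obtain ⟨t, htalg, hpt, hmt⟩ := exists_algebraic_partner_of_hodgeIndex (hHI A₂.X) hL hA₂
    (𝟙 A₂ + φ₂).hom.hom.hom hα hbp' hbm' hbr hbH hb0
  -- `pr₂^* t` is algebraic on `A₁ × A₂`, hence so are `P±± ∪ pr₂^* t` (moving divisors)
  have ht' : complexBetti.map (AbelianVariety.snd A₁ A₂).hom.hom.hom (2 * 1) t ∈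
      algebraicClasses (A₁.prod A₂).X 1 :=
    map_snd_mem_supportedClasses hA₁ hA₂ htalg
  have halgp := HodgeTheory.AbelianVariety.cupProduct_mem_algebraicClasses_one (A₁.prod A₂) hP ht'
  have halgm := HodgeTheory.AbelianVariety.cupProduct_mem_algebraicClasses_one (A₁.prod A₂) hM ht'
  -- the fibre integrals `pr_{1*} pr₂^*(u± ∪ t) ≠ 0`
  have hjj' : 2 * 1 + 2 * 1 = 2 * (2 * 1) := rfl
  have hpt' : cupProduct hjj' bp t ≠ 0 := hpt
  have hmt' : cupProduct hjj' bm t ≠ 0 := hmt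
  have hnep := complexGysin_fst_map_snd_ne_zero μ hA₁ hA₂ hpt'
  have hnem := complexGysin_fst_map_snd_ne_zero μ hA₁ hA₂ hmt'
  -- Schoen's transfer, component by component
  refine Submodule.add_mem _ ?_ ?_
  · exact mem_algebraicClasses_of_complexGysin_fst_cupProduct μ hA₁ hA₂ (l := n) (j := 2 * 1)
      (j' := 2 * 1) (s := 2 * (n + 1)) h hjj' hnep halgp
  · exact mem_algebraicClasses_of_complexGysin_fst_cupProduct μ hA₁ hA₂ (l := n) (j := 2 * 1)
      (j' := 2 * 1) (s := 2 * (n + 1)) h hjj' hnem halgm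

/-! ### The stub, conditionally: the three-line assembly, uniform in `n` -/

/-- **`stub_descend` from the two printed facts (registered sub-goal `stub_descend_of_partner_of_schoen`
of stmt-HodgeConjecture-1333).** Given the partner-surface fact (i)_all and Schoen's transfer
(iii)_all, for `n ≥ 2`, `d ≥ 1`: split Weil `2(n+1)`-folds in the hyperplane convention
(`Stubs.WeilAlgebraicSplitHyperplane (n + 1) d`) give ALL Weil-type `2n`-folds (`WeilAlgebraicAll n d`).
Proof = `Markman2025_weilClasses_algebraic_abelianFourfold_holds_of` with `2 ↦ n`: for `c = 0`
nothing to prove; otherwise `c` witnesses Weil type, (i)_all gives the partner `(S, ψ)` making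
`(A × S, φ × ψ)` a split `2(n+1)`-fold (`dim = 2(n+1)`, `(φ × ψ)² = -d` by `dim_prod_eq_two_mul`,
`prodLift_comp_self_eq_neg_nsmul`), the hypothesis makes its rational `(n+1,n+1)` Weil classes
algebraic, and (iii)_all returns to `A`. CONDITIONAL on the two facts (the verbatim stub has no fact
hypotheses and is not closed here). [cite: Markman2025SurveySecant, §11.5 Step 2]
[cite: Schoen1998HodgeWeilAddendum, §10 (Proposition and proof, pp. 332–333)] -/
theorem stub_descend_of_partner_of_schoen :
    Literature.AlgebraicGeometry.HodgeTheory.exists_weilTypeSurface_prod_isHyperbolicWeilType_all → Literature.AlgebraicGeometry.HodgeTheory.Schoen1998_weilClasses_algebraic_of_prod_surface_all → ∀ n d : ℕ, 2 ≤ n → 0 < d → Stubs.WeilAlgebraicSplitHyperplane (n + 1) d → WeilAlgebraicAll n d := by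
  intro h₂ h₃ n d hn hd H A φ hA hφ c hcW hc hH
  by_cases hc0 : c = 0
  · rw [hc0]; exact Submodule.zero_mem _
  have hX : IsSmoothProjective (2 * n) A.X := by
    rw [← hA]; exact AbelianVariety.isSmoothProjective_holds
  obtain ⟨S, ψ, hS, hXS, hψ, hwt, e, a, ha, ha0, hhyp⟩ :=
    h₂ n (by omega) d hd A φ hA hX hφ ⟨c, hc, hH, hcW, hc0⟩
  have hBdim : (A.prod S).dim = 2 * (n + 1) := dim_prod_eq_two_mul hA hS
  have hS6 := fun c' (hc' : IsRationalClass c') hH' hW' =>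
    H (A.prod S) _ e a hBdim (prodLift_comp_self_eq_neg_nsmul hφ hψ) ha ha0 hhyp c' hW' hc' hH'
  exact h₃ n (by omega) d hd A φ S ψ hA hX hφ hS hXS hψ hwt hS6 c hc hH hcW

/-- **`stub_descend` granted ONE new fact and two classical ones**: the partner-surface fact
(i)_all, Lefschetz `(1,1)` and the Hodge index theorem for surfaces imply the stub verbatim
(Schoen's transfer being proved above). [cite: Markman2025SurveySecant, §11.5 Step 2]
[cite: Schoen1998HodgeWeilAddendum, §10 (Proposition and proof, pp. 332–333)] -/
theorem stub_descend_of_partner_of_lefschetzOneOne_of_hodgeIndex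
    (h₂ : Literature.AlgebraicGeometry.HodgeTheory.exists_weilTypeSurface_prod_isHyperbolicWeilType_all)
    (hL : lefschetzOneOne_rational) (hHI : ∀ X : SchemeOver ℂ, hodgeIndex_surface X) :
    ∀ n d : ℕ, 2 ≤ n → 0 < d → Stubs.WeilAlgebraicSplitHyperplane (n + 1) d → WeilAlgebraicAll n d :=
  stub_descend_of_partner_of_schoen h₂
    (Schoen1998_weilClasses_algebraic_of_prod_surface_all_of_lefschetzOneOne_of_hodgeIndex hL hHI)

/-! ### Upper bound: the stub is an instance of the summit -/

/-- The stub's conclusion is HC-implied (the Hodge conjecture for abelian `2n`-folds gives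
`WeilAlgebraicAll n d` outright, whatever the split hypothesis). [cite: Deligne2000, §1] -/
theorem descend_of_hodgeConjectureFor
    (h : ∀ (m : ℕ) (A : AbelianVariety ℂ), A.dim = 2 * m → HodgeConjectureFor (2 * m) A.X) :
    ∀ n d : ℕ, 2 ≤ n → 0 < d → Stubs.WeilAlgebraicSplitHyperplane (n + 1) d → WeilAlgebraicAll n d :=
  fun n _ _ _ _ A _ hA _ => weilAlgebraicFor_of_hodgeConjectureFor (h n A hA)

end Summit.HodgeConjecture.HodgeConjecture.Cruxes.HodgeAbelianVarieties.EStepSecantInduction.Stubs.Descend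

end
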